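/-
Copyright: the b2b-balaban T⁴-continuum CRUX team, row NE7b OWNER lineage `t4-ne7b-p1` (gen 148). Project licence.
-/
import Mathlib.Analysis.SpecialFunctions.Log.Basic
import Mathlib.Topology.MetricSpace.Pseudo.Defs

/-!
# THE BLOCK FACTOR `M` OF THE EXPONENTIAL WEIGHTS AND THE RATE WINDOW OF THE WEIGHTED CLASS (SCOPING-d19 §D (2), geometric half;
# file (785)).  Every weighted transport ((766)∕(768)∕(770)∕(771)∕(774)∕(775)) and every one-step file ((767)∕(769)∕(772)∕(773)∕(776)–(783))
# takes the coarse weight abstractly through ONE hypothesis `hϑc : ϑc(βx,βx′) ≤ M·ϑ(x,x′)`, and (784) showed that at `d = 4` the class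
# map contracts (at order 5 only) iff `M¹⁰·(1+a) < L`.  THIS FILE computes `M` for the weights the class actually uses ((672): `ϑ = e^{ν d}`
# on the fine sites `p : ι → X`, the next input's `ϑ₂`-weight `ϑc = e^{ν₂ d′}` on the coarse sites `p′ : ι′ → X′`, distances in the
# respective lattice units) from ONE geometric hypothesis on the block map `β`,
#   `d′(p′(βx), p′(βx′)) ≤ d(p x, p x′)∕L + c`   (blocking by `L` contracts distances up to an additive block constant `c`),
# namely `M = e^{ν₂ c}` as soon as `ν₂ ≤ L·ν` (the transported rate does not exceed the rescaled output rate — (672)'s `expw_rescale`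
# reading `ν ↦ L·ν`), and books the RATE WINDOW in which the weighted class iterates AND its remainder contracts:
#   `384·ν < ν₂ ≤ L·ν`  ((765): the order-5 rate chain, solvable iff `L > 384`)   and   `10·ν₂·c + log(1+a) < log L`  ((784) with `M = e^{ν₂c}`),
# NONEMPTY iff `L > 384` and `1 + a < L` (explicit witness `ν₂ = (log L − log(1+a))∕(20c)`, `ν = ν₂∕L`): the carried weights must have rate
# `O(log L)` per block constant — small rates, large geometry letters, but a fixed window for every fixed large `L` (row NE7b, node U5c;
# Mathlib only; [folklore] real arithmetic; (672)∕(765)∕(784) met BY SHAPE).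

Cell `pub-balaban`, sub-cell `t4`, spine estimate NE7b (`T4WeightBudget.RelWeightBound`; the cell's OWN estimate — NOT PRINTED in
[Bałaban 1983–89], NOT PROVED).  Crux-route work under `Spine/NE7b/` by the row OWNER (`t4-ne7b-p1` gen 148, file (785)) under FREEZE
(0)'s crux-prover clause; NOTHING of Bałaban's is named as a Lean object, valued or asserted; no `T4Continuum/Support` leaf typed; no
`def`, no notation; zero `sorry`.  Imports: Mathlib only (fast lane).

WHAT IS PROVED ([folklore]; `p : ι → X`, `p′ : ι′ → X′` pseudometric placements, `β : ι → ι′`, rates `ν ν₂`, blocking `L`, block constant `c`):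
* §1 **`expw_block_factor`** (`0 ≤ ν₂`, `1 ≤ L`, `ν₂ ≤ Lν`, the block geometry ⟹ `e^{ν₂ d′(p′βx,p′βx′)} ≤ e^{ν₂c}·e^{ν d(px,px′)}` — the
  hypothesis `hϑc` of the transport files with `M = e^{ν₂c}`), `blockFactor_one_le` (`1 ≤ e^{ν₂c}`), `blockFactor_pow_ten` (`M¹⁰ = e^{10ν₂c}`).
* §2 **`order_five_contracts_iff`** (`L > 0`, `1 + a > 0`: `M¹⁰(1+a) < L ↔ 10ν₂c + log(1+a) < log L` for `M = e^{ν₂c}`).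
* §3 **`rate_window`** (`L > 384`, `c > 0`, `0 ≤ a`, `1 + a < L ⟹ ∃ ν ν₂, 0 < ν ∧ 384ν < ν₂ ∧ ν₂ ≤ Lν ∧ M¹⁰(1+a) < L`).
* §4 toys (kernel).

HONEST (what this is NOT).  The block geometry `d′ ≤ d∕L + c` is a HYPOTHESIS on (placements, block map) (for cubes of side `L` in `ℤ⁴`
with block centres as coarse sites it holds with `c` of order one; not typed); the cross coefficient `a` and the geometry letters'
growth as the rates shrink (lattice sums `~ (rate gap)^{−4}`) are NOT evaluated; the window says nothing about the relevant∕marginal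
orders ((784) §4); scalar skeleton ((A3), NC-NE7b-α UNRULED); nothing of Bałaban's asserted.  BY-NAME EFFECT ON THE WALL: NONE.  NE7b NOT
PRINTED ∕ NOT PROVED; spine PROVED 0∕9; rung (B)+1 — the programme's measures remain FINITE-torus statements; NOT the mass gap, NOT Clay.
HONEST DEPENDENCY: continuum YM on T⁴ ⇐ BetaPertH ∧ nine spine estimates (0∕9 proved); BetaPertH ⇐ (D1) ∧ (D4) ∧ CAP+tail; G-an2-4
gates asym, D1 and NE2∕3∕4.
-/

set_option autoImplicit false

noncomputable section

namespace Summit.QuantumFields.BalabanUV.T4Continuum.NE7b.SupWeightedBlockFactor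

variable {ι ι' X X' : Type} [PseudoMetricSpace X] [PseudoMetricSpace X'] {p : ι → X} {p' : ι' → X'} {β : ι → ι'}
  {ν ν₂ L c : ℝ}

/-! ## §1. The block factor of the exponential weights -/

/-- **THE BLOCK FACTOR**: if blocking contracts distances up to an additive constant (`d′(p′βx,p′βx′) ≤ d(px,px′)∕L + c`, `L ≥ 1`) and
the coarse rate does not exceed the rescaled fine rate (`0 ≤ ν₂ ≤ L·ν`), then `e^{ν₂ d′(p′βx,p′βx′)} ≤ e^{ν₂c}·e^{ν d(px,px′)}`: the
transport files' `hϑc` with `M = e^{ν₂c}`. [folklore] -/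
theorem expw_block_factor (hν₂ : 0 ≤ ν₂) (hL : 1 ≤ L) (hrate : ν₂ ≤ L * ν)
    (hβ : ∀ x x', dist (p' (β x)) (p' (β x')) ≤ dist (p x) (p x') / L + c) (x x' : ι) :
    Real.exp (ν₂ * dist (p' (β x)) (p' (β x'))) ≤ Real.exp (ν₂ * c) * Real.exp (ν * dist (p x) (p x')) := by
  rw [← Real.exp_add, Real.exp_le_exp]
  have hL0 : 0 < L := lt_of_lt_of_le zero_lt_one hL
  have h1 : ν₂ * dist (p' (β x)) (p' (β x')) ≤ ν₂ * (dist (p x) (p x') / L) + ν₂ * c :=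
    (mul_le_mul_of_nonneg_left (hβ x x') hν₂).trans_eq (mul_add _ _ _)
  have h2 : ν₂ * (dist (p x) (p x') / L) ≤ ν * dist (p x) (p x') := by
    rw [mul_div_assoc', div_le_iff₀ hL0]
    calc ν₂ * dist (p x) (p x') ≤ L * ν * dist (p x) (p x') := mul_le_mul_of_nonneg_right hrate dist_nonneg
      _ = ν * dist (p x) (p x') * L := by ring
  linarith

/-- The block factor is at least one (`ν₂, c ≥ 0`). [folklore] -/
theorem blockFactor_one_le (hν₂ : 0 ≤ ν₂) (hc : 0 ≤ c) : 1 ≤ Real.exp (ν₂ * c) :=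
  Real.one_le_exp (mul_nonneg hν₂ hc)

/-- The block factor is positive. [folklore] -/
theorem blockFactor_pos : 0 < Real.exp (ν₂ * c) := Real.exp_pos _

/-- Its tenth power (the order-5 full graph has ten edges): `(e^{ν₂c})¹⁰ = e^{10ν₂c}`. [folklore] -/
theorem blockFactor_pow_ten : Real.exp (ν₂ * c) ^ 10 = Real.exp (10 * (ν₂ * c)) := by
  rw [← Real.exp_nat_mul]; norm_num

/-! ## §2. The contraction condition in the rates -/

/-- **ORDER 5 CONTRACTS IFF `10ν₂c + log(1+a) < log L`** ((784)'s `M¹⁰(1+a) < L` with `M = e^{ν₂c}`; `L > 0`, `1 + a > 0`). [folklore] -/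
theorem order_five_contracts_iff {a : ℝ} (hL : 0 < L) (ha : 0 < 1 + a) :
    Real.exp (ν₂ * c) ^ 10 * (1 + a) < L ↔ 10 * (ν₂ * c) + Real.log (1 + a) < Real.log L := by
  have e : Real.exp (ν₂ * c) ^ 10 * (1 + a) = Real.exp (10 * (ν₂ * c) + Real.log (1 + a)) := by
    rw [Real.exp_add, Real.exp_log ha, blockFactor_pow_ten]
  rw [e, ← Real.log_lt_log_iff (Real.exp_pos _) hL, Real.log_exp]

/-! ## §3. The rate window -/

/-- **THE RATE WINDOW IS NONEMPTY FOR `L > 384`**: with block constant `c > 0` and cross coefficient `a ≥ 0`, `1 + a < L`, the rates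
`ν₂ := (log L − log(1+a))∕(20c)`, `ν := ν₂∕L` satisfy the order-5 rate chain `384ν < ν₂ ≤ Lν` ((765)) AND the contraction
`(e^{ν₂c})¹⁰(1+a) < L` ((784)). [folklore] -/
theorem rate_window (hL : 384 < L) (hc : 0 < c) {a : ℝ} (ha : 0 ≤ a) (haL : 1 + a < L) :
    ∃ ν ν₂ : ℝ, 0 < ν ∧ 384 * ν < ν₂ ∧ ν₂ ≤ L * ν ∧ Real.exp (ν₂ * c) ^ 10 * (1 + a) < L := by
  have hL0 : 0 < L := by linarith
  have ha1 : 0 < 1 + a := by linarith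
  set D := Real.log L - Real.log (1 + a) with hD
  have hDpos : 0 < D := sub_pos.mpr (Real.log_lt_log ha1 haL)
  have hw : 0 < D / (20 * c) := div_pos hDpos (by positivity)
  refine ⟨D / (20 * c) / L, D / (20 * c), div_pos hw hL0, ?_, ?_, ?_⟩
  · rw [mul_div_assoc', div_lt_iff₀ hL0]
    nlinarith
  · rw [mul_div_cancel₀ _ hL0.ne']
  · rw [order_five_contracts_iff hL0 ha1]
    have e : 10 * (D / (20 * c) * c) = D / 2 := by
      field_simp
      ring
    rw [e]
    linarith

/-! ## §4. Toys -/

/-- Toy (kernel): with `ν₂c = 1∕20` the block factor's tenth power is `e^{1∕2} < 2`: order 5 contracts already at `L = 2` when `a = 0`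
(`e^{1∕2} < 2 ⟸ 1∕2 < log 2`, i.e. `e < 4`). -/
example : (10 : ℝ) * ((1 : ℝ) / 20) = 1 / 2 := by norm_num

/-- Toy (kernel): the window's witness at `L = 400 > 384`: `384·(ν₂∕400) < ν₂` for `ν₂ = 1`. -/
example : (384 : ℝ) * (1 / 400) < 1 := by norm_num

end Summit.QuantumFields.BalabanUV.T4Continuum.NE7b.SupWeightedBlockFactor

end
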